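import Summits.QuantumFields.YangMills.Theorems.BalabanUVNodesN22W1RelCentredTermDatum214
import Summits.QuantumFields.YangMills.Theorems.BalabanUVNodesN22W1RelCentredSector
import Summits.QuantumFields.YangMills.Theorems.BalabanUVNodesN22W1StripNumeralsAnyM

/-!
# BalabanUVNodes ∕ node N22 = NE9 — THE W1 OBJECT ON THE RELATIVE-DISC CENTRED ROAD (RE-TYPING M1′), MODULE R4: THE NUMERIC CONJUNCTS OF THE RE-TYPED LEAF ARE JOINTLY
# SATISFIABLE — at every `M` and every window radius `γ > 0`, with the SECTOR as the domain family (referees' A-column «clauses jointly satisfiable» for R2 ∕ R2b)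

Cell `pub-ymgap`, HUMAN RULING D-0062 (Track A), R134 ACCELERATION re-seat `pub-ymgap-dag-n22-c` (strategy s1), generation 6, file R4 of the re-typed line.  THEOREMS ONLY; imports R2
`…N22W1RelCentredTermDatum214` (`two_mul_exp_le_exp_add_log_two`), R3 `…N22W1RelCentredSector` (`relSector_domainClauses`) and this lineage's 17′ `…N22W1StripNumeralsAnyM`
(`lemma3Numerics_consts_anyM`, `stripNumerics_consts` at the tree's witness `B13Lemma3TorusNonvacuity.consts`) BY NAME.  `--supports` K3⁗ `SpineGivenEndpointR13Sep`
(stmt-QuantumFields-20292) as a helper.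

WHAT.  `relCentredLeafNumerals_nonvacuous_anyM` — for every `M` and every `γ > 0` there are letter inputs `li`, socket constants `c = consts`, `L = consts.L`, socket letters
`(a, a₂, a₂′, a₅, a₅′, Aabs) = (aw + 40M, 1, 1, ½ − log 2, ½, 1)`, `r₁ = consts.κ`, `E₀ = 2`, `Mv = 2∕(9γ²)`, `cA = ½` and the constant SECTOR family `D := fun _ ↦ {z | ∃ t ∈ ]0,γ],
dist z t < ¾·t}` satisfying EVERY numeric conjunct of R2b's `hnum` and `hdata`: the letter signs with `li.s = ½`, `li.μ = 1`, the socket numerals at `a₅′`, `0 ≤ C₃ε₁`, S25's two clauses,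
the renewal `… ≤ E₀`, the weight slack `2·e^{a₅|Z|} ≤ e^{a₅′|Z|}` for EVERY localization domain of EVERY torus, the three domain clauses (open, window points, relative discs of
aperture `cA`), `0 < cA < 1`, `0 < Mv`, `Mv·((1+cA)γ)² ≤ ½`, `2·Mv·E₀·(1+cA)² ≤ li.A`, `li.r ≤ min(cA, 1)`.  (The DATA-dependent conjuncts — `Gn = 𝔇.Gn`, the table inclusion, the
real-window agreement and the four per-term schemas — are not numerals and are not touched: they are the content.)  §2 (v1.1) `relCentredLeafNumerals_nonvacuous_anyAperture`:
the same at EVERY relative aperture `0 < cA < c ≤ 1` with the sector of aperture `c` (`Mv := 1∕(2((1+cA)γ)²)`, `li.A := 2∕γ²`, `li.r := cA`) — the leaf's numerals do not constrain `cA`;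
the producer's phase price `2ν·cA²` (lens transfer (k3)) is the producer's `a₅` business, not the leaf's.

HONEST FRAMING.  Count-neutral arithmetic; shows the re-typed leaf is not vacuous BY ITS NUMERALS (the display letter `a₅ = ½ − log 2` is negative — a demand on the (2.26) supplier's
weight, not a contradiction); nothing of Bałaban's asserted; N22 NOT discharged.  0 `sorry`, 0 `def`, standard axioms.

References (TYPES only): [I] = [Balaban1987RG1] §1 p. 263; [II] = [Balaban1988RG2Cluster] (2.26) p. 17, (2.31) p. 18, Lemma 3 p. 20.
-/

noncomputable section

namespace YMDAG.N22.W1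

open Set Metric
open scoped BigOperators
open Literature.MathematicalPhysics.QuantumFieldTheory.Balaban1983to89
open Literature.MathematicalPhysics.QuantumFieldTheory.Balaban1983to89.TreeLengthTorus (TDom)
open Literature.MathematicalPhysics.QuantumFieldTheory.Balaban1983to89.B12TreeDecay (K₀ K₀_pos)
open Literature.MathematicalPhysics.QuantumFieldTheory.Balaban1983to89.B13Lemma3TorusSocket (Lemma3Numerics)
open Literature.MathematicalPhysics.QuantumFieldTheory.Balaban1983to89.B13Lemma3WindowNonvacuity (aw)
open Literature.MathematicalPhysics.QuantumFieldTheory.Balaban1983to89.B13Lemma3TorusNonvacuity (consts numerics_nonvacuous_pos_consts consts_L)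
open Literature.MathematicalPhysics.QuantumFieldTheory.Balaban1983to89.Node00.W1 (LetterInputs)

/-- **THE NUMERIC CONJUNCTS OF THE RE-TYPED LEAF ARE JOINTLY SATISFIABLE AT EVERY `M` AND EVERY WINDOW RADIUS `γ > 0`, WITH THE SECTOR AS DOMAIN FAMILY.**  Witness: `li :=
⟨consts.κ, ½, 0, 0, 0, 1, 2∕γ² + 2, 1, ½, ½⟩`, `c := consts`, socket letters `(aw + 40M, 1, 1, ½ − log 2, ½, 1)` (17′ `lemma3Numerics_consts_anyM` at `a₅′ = ½`), `r₁ := consts.κ`, `E₀ := 2`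
(= `consts.E₀`, 17′ `stripNumerics_consts`), `Mv := 2∕(9γ²)`, `cA := ½`, `D := fun _ ↦` the sector of aperture `¾` (R3 `relSector_domainClauses`), the slack by R2
`two_mul_exp_le_exp_add_log_two`. [cite: Balaban1988RG2Cluster, (2.26) p.17, (2.31) p.18 and Lemma 3 p.20; Balaban1987RG1, §1 p.263] -/
theorem relCentredLeafNumerals_nonvacuous_anyM (M : ℕ) {γ : ℝ} (hγ : 0 < γ) :
    ∃ (li : LetterInputs) (c : B13.Consts) (L : ℕ) (a a₂ a₂' a₅ a₅' Aabs r₁ E₀ Mv cA : ℝ) (D : ℕ → Set ℂ),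
      (0 < li.C₀ ∧ 0 < li.θ₅ ∧ li.θ₅ < 1 ∧ 0 ≤ li.C₅ ∧ 2 * li.C₅ / (1 - li.θ₅) ≤ li.C₀ ∧ 0 < li.A ∧ li.μ = 1 ∧ 0 < li.r ∧ li.s = (2 : ℝ)⁻¹) ∧
      8 ≤ c.L ∧ c.L = L ∧ Lemma3Numerics c M ((c.L : ℝ) / 2) a a₂ a₂' a₅' Aabs ∧ 0 ≤ c.C3act * c.ε₁ ∧ 0 ≤ r₁ ∧ li.κ ≤ r₁ ∧
      r₁ + 2 * (64 * Real.log 162) + 2 ≤ (1 - 8 * c.δ) * ((c.L : ℝ) / 2) * c.κ ∧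
      c.C3act * c.ε₁ * Real.exp (5 * r₁ + 1) * K₀ 64 8 * 9 * 64 ≤ 1 ∧
      Real.exp 1 * 9 * 64 * K₀ 64 8 ^ 2 * (c.C3act * c.ε₁) ≤ E₀ ∧
      (∀ {d n : ℕ} [NeZero n] (Z : TDom d n), 2 * Real.exp (a₅ * ((Z.1).card : ℝ)) ≤ Real.exp (a₅' * ((Z.1).card : ℝ))) ∧
      (∀ i, IsOpen (D i)) ∧ (∀ (i : ℕ), ∀ t ∈ Ioc (0 : ℝ) γ, ((t : ℝ) : ℂ) ∈ D i) ∧ (∀ (i : ℕ), ∀ t ∈ Ioc (0 : ℝ) γ, closedBall (t : ℂ) (cA * t) ⊆ D i) ∧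
      0 < cA ∧ cA < 1 ∧ 0 < Mv ∧ Mv * ((1 + cA) * γ) ^ 2 ≤ 1 / 2 ∧ 2 * Mv * E₀ * (1 + cA) ^ 2 ≤ li.A ∧ li.r ≤ min cA 1 := by
  obtain ⟨hL, -, hC3pos, hκ, hκr, hlarge, hsmall, hrenew⟩ := stripNumerics_consts
  have hE₀ : consts.E₀ = 2 := rfl
  have hγ2 : 0 < γ ^ 2 := by positivity
  refine ⟨⟨consts.κ, 1 / 2, 0, 0, 0, 1, 2 / γ ^ 2 + 2, 1, 1 / 2, (2 : ℝ)⁻¹⟩, consts, consts.L, aw + 40 * (M : ℝ), 1, 1, 1 / 2 - Real.log 2, 1 / 2, 1, consts.κ, 2,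
    2 / (9 * γ ^ 2), 1 / 2, fun _ => {z : ℂ | ∃ t ∈ Ioc (0 : ℝ) γ, dist z (t : ℂ) < 3 / 4 * t}, ?_, hL, rfl, lemma3Numerics_consts_anyM M, hC3pos, hκ, hκr, hlarge, hsmall,
    by rw [← hE₀]; exact hrenew, fun Z => ?_, ?_⟩
  · refine ⟨by norm_num, by norm_num, by norm_num, le_rfl, by norm_num, by positivity, rfl, by norm_num, rfl⟩
  · have h := two_mul_exp_le_exp_add_log_two (1 / 2 - Real.log 2) Z
    rwa [sub_add_cancel] at h
  · obtain ⟨ho, hw, hd⟩ := relSector_domainClauses (γ := γ) (c := 3 / 4) (cA := 1 / 2) (by norm_num) (by norm_num)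
    refine ⟨ho, hw, hd, by norm_num, by norm_num, by positivity, ?_, ?_, by norm_num⟩
    · have : 2 / (9 * γ ^ 2) * ((1 + 1 / 2) * γ) ^ 2 = 1 / 2 := by field_simp; ring
      rw [this]
    · show 2 * (2 / (9 * γ ^ 2)) * 2 * (1 + 1 / 2) ^ 2 ≤ 2 / γ ^ 2 + 2
      have : 2 * (2 / (9 * γ ^ 2)) * 2 * (1 + 1 / 2) ^ 2 = 2 / γ ^ 2 := by field_simp; ring
      rw [this]
      linarith

/-! ## §2 (v1.1) The same at EVERY relative aperture `0 < cA < c ≤ 1` — the leaf's numerals do not constrain `cA` (lens transfer g10 (k3): the producer's phase price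
`2ν·cA²` of [II] (2.15) at the phased precision is booked on the PRODUCER's display letter `a₅`, so the affordable aperture is `cA = O(ν^{−1∕2})`; this file's job is only
that the LEAF accepts every such `cA`) -/

/-- **THE NUMERIC CONJUNCTS OF THE RE-TYPED LEAF ARE JOINTLY SATISFIABLE AT EVERY `M`, EVERY WINDOW RADIUS `γ > 0` AND EVERY RELATIVE APERTURE `0 < cA < c ≤ 1`, WITH THE
SECTOR OF APERTURE `c` AS DOMAIN FAMILY** (take `c ≤ ½` to sit inside the quarter-plane `|Im z| < Re z` of R3 `abs_im_lt_re_of_mem_relSector`).  Witness: as in §1 but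
`Mv := 1 ∕ (2·((1+cA)·γ)²)` (so `Mv·((1+cA)γ)² = ½` on the nose and `2·Mv·E₀·(1+cA)² = 2∕γ²`), `li.A := 2∕γ²`, `li.r := cA` (`≤ min cA 1` as `cA < c ≤ 1`), `D := fun _ ↦
{z | ∃ t ∈ ]0,γ], dist z t < c·t}` (R3 `relSector_domainClauses` at `cA < c`).  v1.0's `relCentredLeafNumerals_nonvacuous_anyM` is the instance `cA = ½`, `c = ¾` up to the
choice of `Mv`.  HONEST: count-neutral arithmetic; the `2ν·cA²` price of the producer (lens T19 ∕ E4) is NOT modelled here — it lives in the producer's `a₅`, which this leaf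
only displays. [cite: Balaban1988RG2Cluster, (2.15) p.15, (2.26) p.17, (2.31) p.18 and Lemma 3 p.20; Balaban1987RG1, §1 p.263] -/
theorem relCentredLeafNumerals_nonvacuous_anyAperture (M : ℕ) {γ cA c : ℝ} (hγ : 0 < γ) (hcA0 : 0 < cA) (hcAc : cA < c) (hc1 : c ≤ 1) :
    ∃ (li : LetterInputs) (cs : B13.Consts) (L : ℕ) (a a₂ a₂' a₅ a₅' Aabs r₁ E₀ Mv : ℝ) (D : ℕ → Set ℂ),
      (0 < li.C₀ ∧ 0 < li.θ₅ ∧ li.θ₅ < 1 ∧ 0 ≤ li.C₅ ∧ 2 * li.C₅ / (1 - li.θ₅) ≤ li.C₀ ∧ 0 < li.A ∧ li.μ = 1 ∧ 0 < li.r ∧ li.s = (2 : ℝ)⁻¹) ∧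
      8 ≤ cs.L ∧ cs.L = L ∧ Lemma3Numerics cs M ((cs.L : ℝ) / 2) a a₂ a₂' a₅' Aabs ∧ 0 ≤ cs.C3act * cs.ε₁ ∧ 0 ≤ r₁ ∧ li.κ ≤ r₁ ∧
      r₁ + 2 * (64 * Real.log 162) + 2 ≤ (1 - 8 * cs.δ) * ((cs.L : ℝ) / 2) * cs.κ ∧
      cs.C3act * cs.ε₁ * Real.exp (5 * r₁ + 1) * K₀ 64 8 * 9 * 64 ≤ 1 ∧
      Real.exp 1 * 9 * 64 * K₀ 64 8 ^ 2 * (cs.C3act * cs.ε₁) ≤ E₀ ∧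
      (∀ {d n : ℕ} [NeZero n] (Z : TDom d n), 2 * Real.exp (a₅ * ((Z.1).card : ℝ)) ≤ Real.exp (a₅' * ((Z.1).card : ℝ))) ∧
      (∀ i, IsOpen (D i)) ∧ (∀ (i : ℕ), ∀ t ∈ Ioc (0 : ℝ) γ, ((t : ℝ) : ℂ) ∈ D i) ∧ (∀ (i : ℕ), ∀ t ∈ Ioc (0 : ℝ) γ, closedBall (t : ℂ) (cA * t) ⊆ D i) ∧
      0 < cA ∧ cA < 1 ∧ 0 < Mv ∧ Mv * ((1 + cA) * γ) ^ 2 ≤ 1 / 2 ∧ 2 * Mv * E₀ * (1 + cA) ^ 2 ≤ li.A ∧ li.r ≤ min cA 1 := by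
  obtain ⟨hL, -, hC3pos, hκ, hκr, hlarge, hsmall, hrenew⟩ := stripNumerics_consts
  have hE₀ : consts.E₀ = 2 := rfl
  have hγ2 : 0 < γ ^ 2 := by positivity
  have hcA1 : cA < 1 := lt_of_lt_of_le hcAc hc1
  have h1cA : 0 < (1 + cA) * γ := by positivity
  refine ⟨⟨consts.κ, 1 / 2, 0, 0, 0, 1, 2 / γ ^ 2, 1, cA, (2 : ℝ)⁻¹⟩, consts, consts.L, aw + 40 * (M : ℝ), 1, 1, 1 / 2 - Real.log 2, 1 / 2, 1, consts.κ, 2,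
    1 / (2 * ((1 + cA) * γ) ^ 2), fun _ => {z : ℂ | ∃ t ∈ Ioc (0 : ℝ) γ, dist z (t : ℂ) < c * t}, ?_, hL, rfl, lemma3Numerics_consts_anyM M, hC3pos, hκ, hκr, hlarge,
    hsmall, by rw [← hE₀]; exact hrenew, fun Z => ?_, ?_⟩
  · exact ⟨by norm_num, by norm_num, by norm_num, le_rfl, by norm_num, by positivity, rfl, hcA0, rfl⟩
  · have h := two_mul_exp_le_exp_add_log_two (1 / 2 - Real.log 2) Z
    rwa [sub_add_cancel] at h
  · obtain ⟨ho, hw, hd⟩ := relSector_domainClauses (γ := γ) hcA0 hcAc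
    refine ⟨ho, hw, hd, hcA0, hcA1, by positivity, ?_, ?_, le_min le_rfl hcA1.le⟩
    · have : 1 / (2 * ((1 + cA) * γ) ^ 2) * ((1 + cA) * γ) ^ 2 = 1 / 2 := by field_simp
      rw [this]
    · show 2 * (1 / (2 * ((1 + cA) * γ) ^ 2)) * 2 * (1 + cA) ^ 2 ≤ 2 / γ ^ 2
      have : 2 * (1 / (2 * ((1 + cA) * γ) ^ 2)) * 2 * (1 + cA) ^ 2 = 2 / γ ^ 2 := by field_simp
      rw [this]


/-! ## §3 (v1.2, append-only) The numeric conjuncts of the WINDOW-DILATED leaf (J2 ∕ J3 ∕ J4) are jointly satisfiable at every aperture pair `0 < cA < cP < ½` -/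

/-- **THE NUMERIC CONJUNCTS OF THE WINDOW-DILATED LEAF ARE JOINTLY SATISFIABLE, AT EVERY `M`, EVERY WINDOW RADIUS `γ > 0` AND EVERY APERTURE PAIR `0 < cA < cP < ½`** (the A-column
«clauses jointly satisfiable» for J2 `…TermDatum214WindowDilated` ∕ J3 `…WindowDilatedKeyedCoP` ∕ J4): the letter signs, the socket numerals AT `a₅′` with the slack, S25, the renewal
`… ≤ E₀`, AND the window-dilated numerals — displayed-disc aperture `cA` below the producer's sector aperture `cP`, a ball radius `ρb` with `cP∕(1−cP) < ρb < 1` (dag-n10-c g6's §4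
theorems ask `ρb < 1`; such a radius exists iff `cP < ½`), `0 < Mv`, the smallness `(1−cP)⁻²·Mv·((1+cA)γ)² ≤ ½`, the letter relation `2·((1−cP)⁻²·Mv)·E₀·(1+cA)² ≤ li.A` and
`li.r ≤ min(cA, 1)` — hold together: §2 at the aperture pair `(cA, cP)` with its centred letter RESCALED, `Mv := (1−cP)²·Mv₀` (so `(1−cP)⁻²·Mv = Mv₀ = 1∕(2((1+cA)γ)²)`), and
`ρb := (cP∕(1−cP) + 1)∕2`.  Pure arithmetic on top of v1.1; shows the conjunction J3's tuple displays is not vacuous by its numerals (the member statements are the producer's).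
[cite: Balaban1988RG2Cluster, (2.24)-(2.26) p.17, Lemma 3 p.20 and (2.39)-(2.41) p.21; Balaban1987RG1, (2.9)-(2.10) pp.266-267] -/
theorem windowDilatedLeafNumerals_nonvacuous (M : ℕ) {γ cA cP : ℝ} (hγ : 0 < γ) (hcA0 : 0 < cA) (hcAP : cA < cP) (hcP : cP < 1 / 2) :
    ∃ (li : LetterInputs) (cs : B13.Consts) (L : ℕ) (a a₂ a₂' a₅ a₅' Aabs r₁ E₀ Mv ρb : ℝ),
      (0 < li.C₀ ∧ 0 < li.θ₅ ∧ li.θ₅ < 1 ∧ 0 ≤ li.C₅ ∧ 2 * li.C₅ / (1 - li.θ₅) ≤ li.C₀ ∧ 0 < li.A ∧ li.μ = 1 ∧ 0 < li.r ∧ li.s = (2 : ℝ)⁻¹) ∧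
      8 ≤ cs.L ∧ cs.L = L ∧ Lemma3Numerics cs M ((cs.L : ℝ) / 2) a a₂ a₂' a₅' Aabs ∧ 0 ≤ cs.C3act * cs.ε₁ ∧ 0 ≤ r₁ ∧ li.κ ≤ r₁ ∧
      r₁ + 2 * (64 * Real.log 162) + 2 ≤ (1 - 8 * cs.δ) * ((cs.L : ℝ) / 2) * cs.κ ∧
      cs.C3act * cs.ε₁ * Real.exp (5 * r₁ + 1) * K₀ 64 8 * 9 * 64 ≤ 1 ∧
      Real.exp 1 * 9 * 64 * K₀ 64 8 ^ 2 * (cs.C3act * cs.ε₁) ≤ E₀ ∧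
      (∀ {d n : ℕ} [NeZero n] (Z : TDom d n), 2 * Real.exp (a₅ * ((Z.1).card : ℝ)) ≤ Real.exp (a₅' * ((Z.1).card : ℝ))) ∧
      0 < cA ∧ cA < cP ∧ cP < 1 ∧ cP / (1 - cP) < ρb ∧ ρb < 1 ∧ 0 < Mv ∧ (1 - cP)⁻¹ ^ 2 * Mv * ((1 + cA) * γ) ^ 2 ≤ 1 / 2 ∧
      2 * ((1 - cP)⁻¹ ^ 2 * Mv) * E₀ * (1 + cA) ^ 2 ≤ li.A ∧ li.r ≤ min cA 1 := by
  have hcP1 : cP < 1 := by linarith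
  have h1cP : 0 < 1 - cP := by linarith
  obtain ⟨li, cs, L, a, a₂, a₂', a₅, a₅', Aabs, r₁, E₀, Mv₀, D, hsig, hL, hLc, hN, hA0, hr₁, hκ, hrate, hsmall, hrenew, h2w, -, -, -, -, -, hMv₀, hMvγ, hAM,
    hrc⟩ := relCentredLeafNumerals_nonvacuous_anyAperture M hγ hcA0 hcAP hcP1.le
  have hq : cP / (1 - cP) < 1 := by rw [div_lt_one h1cP]; linarith
  have hresc : (1 - cP)⁻¹ ^ 2 * ((1 - cP) ^ 2 * Mv₀) = Mv₀ := by field_simp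
  refine ⟨li, cs, L, a, a₂, a₂', a₅, a₅', Aabs, r₁, E₀, (1 - cP) ^ 2 * Mv₀, (cP / (1 - cP) + 1) / 2, hsig, hL, hLc, hN, hA0, hr₁, hκ, hrate, hsmall, hrenew, h2w,
    hcA0, hcAP, hcP1, by linarith, by linarith, by positivity, ?_, ?_, hrc⟩
  · rw [hresc]; exact hMvγ
  · rw [hresc]; exact hAM

end YMDAG.N22.W1

end
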